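import Mathlib
import HarnessLib
import Summits.Ventures.LatticeQCDFlow.Exactness.NCMCGeneralSpaceReplicaPooledGammaCoverage
import Summits.Ventures.LatticeQCDFlow.Exactness.NCMCGeneralSpaceReplicaPooledJarzynski

/-!
# The printed POOLED Γ-method error bar of the Jarzynski lane over `R` independent streams is asymptotically exact: `P{ |ΔF̂_{R,n} − ΔF| ≤ z √(V̂_{R,n}/(R n)) / Ȳ_{R,n} } → N(0,1)([−z, z])` from EVERY family of launch configurations

HONEST FRAMING: exact (Metropolis-corrected) sampling algorithms for lattice gauge theory;
figures of merit are autocorrelation/cost numbers at stated couplings and volumes; no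
continuum-physics claim.

Venture `LatticeQCDFlow` (cell pub-lqcd), topic `Exactness`; FANOUT row 13 (`eng-snf`, GEN-23).
NEW WORK of the cell, not a published result; no definition is introduced; nothing is cited as a
fact.  GEN-22's `NCMCGeneralSpaceRestartChainGammaCoverage` proved that along ONE stream of correlated
launches the printed interval `ΔF̂_n ± z √(Γ̂_n(0) · 2 τ̂_{n,W_n}/n)/Ȳ_n` covers `ΔF` with asymptotically
nominal probability.  With `R` independent streams the engine prints the POOLED estimate
`ΔF̂_{R,n} = −log Ȳ_{R,n}` with the replica-pooled Γ-method statistic of the weight series,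
`V̂_{R,n} = (1/R) Σ_r Γ̂^r_n(0) · 2 τ̂^r_{n,W_n}` (per-replica centring, common window), and the error bar
`√(V̂_{R,n}/(R n))/Ȳ_{R,n}`.  GEN-23's studentized pooled CLT
(`tendstoInDistribution_studentized_pooledSum_of_nHit`, `NCMCGeneralSpaceReplicaPooledGammaCoverage`)
on the restart chain, the pooled strong law of the weights
(`CrooksPair.tendsto_pooledMeanWeight_ae_restartChains`, `NCMCGeneralSpaceReplicaPooledJarzynski`) and
the difference-quotient identity `−log Ȳ + log θ = −(Ȳ − θ) · dslope log θ Ȳ` (GEN-22's route, Slutsky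
via GEN-20's `tendsto_measure_abs_mul_le_of_clt_of_tendstoInMeasure`) give the exactness of that bar.

## Content (Crooks pair, `Z₀ ≠ 0`, `e^{−ΔF} = Z₁/Z₀`; `−B ≤ W`; `K` Markov, `ν₀`-invariant,
## `m ≤ K(z, ·)` for all `z`, `m` finite non-zero; `σ²_w > 0` the Green–Kubo variance of the weights
## along `R = (κF ∘ₖ K).comap s`; windows `W_n → ∞`, `W_n³/n → 0`; `R = card ι ≥ 1` INDEPENDENT
## streams from ANY initial record laws `μ r`; `z > 0`)

* `abs_studentizedLog_le_iff_real` — the event algebra with a real sample size `N > 0`.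
* **`CrooksPair.tendsto_measure_studentized_pooledJarzynski_le_restartChains`** —
  `P{ |√(R n) (ΔF̂_{R,n} − ΔF) · Ȳ_{R,n} · (√V̂_{R,n})⁻¹| ≤ z } → gaussianReal 0 1 (Icc (−z) z)`.
* **`CrooksPair.tendsto_measure_pooledJarzynski_mem_gammaInterval_restartChains`** — THE PRINTED
  FORM: `P{ |ΔF̂_{R,n} − ΔF| ≤ z √(V̂_{R,n}/(R n)) / Ȳ_{R,n} } → gaussianReal 0 1 (Icc (−z) z)`;
  **`…_everyStart`** — replica `r` first launched from ANY configuration `x r`.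

NOT CLAIMED: dependent streams; unequal lengths; centring at the pooled mean; the data-driven window;
unbounded work; `σ²_w > 0` itself; anything numerical.
-/

namespace Summit.Ventures.LatticeQCDFlow.Exactness.GeneralNCMC

open MeasureTheory ProbabilityTheory Set Filter Finset
open scoped ENNReal NNReal Topology

/-! ## §1 The event algebra with a real sample size -/

/-- `|√N D · Y · (√v)⁻¹| ≤ z ↔ |D| ≤ z √(v/N) / Y` for real `N > 0`, `v > 0`, `Y > 0`. -/
theorem abs_studentizedLog_le_iff_real {N : ℝ} (hN : 0 < N) {D Y v z : ℝ} (hv : 0 < v) (hY : 0 < Y) :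
    |Real.sqrt N * D * Y * (Real.sqrt v)⁻¹| ≤ z ↔ |D| ≤ z * Real.sqrt (v / N) / Y := by
  have hsn : 0 < Real.sqrt N := Real.sqrt_pos.2 hN
  have hsv : 0 < Real.sqrt v := Real.sqrt_pos.2 hv
  have hq : 0 < Real.sqrt N * Y * (Real.sqrt v)⁻¹ := by positivity
  rw [show Real.sqrt N * D * Y * (Real.sqrt v)⁻¹ = D * (Real.sqrt N * Y * (Real.sqrt v)⁻¹) by ring,
    abs_mul, abs_of_pos hq, ← le_div_iff₀ hq, Real.sqrt_div' v hN.le]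
  constructor <;> intro h <;> refine h.trans_eq ?_ <;> field_simp

/-! ## §2 The pooled Jarzynski lane -/

variable {Ω E : Type*} [MeasurableSpace Ω] [MeasurableSpace E]

namespace CrooksPair

variable {ν₀ ν₁ : Measure Ω} [IsFiniteMeasure ν₀] [IsFiniteMeasure ν₁] {κF κR : Kernel Ω E}
  [IsMarkovKernel κF] [IsMarkovKernel κR] {s e : E → Ω} {W : E → ℝ}
  {ι : Type*} [Fintype ι] [Nonempty ι]

/-- **THE STUDENTIZED POOLED JARZYNSKI ESTIMATE — EXACT ASYMPTOTIC COVERAGE FROM EVERY FAMILY OF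
INITIAL RECORD LAWS.**  Crooks pair with `Z₀ ≠ 0`, `e^{−ΔF} = Z₁/Z₀`; `−B ≤ W`; `K` Markov,
`ν₀`-invariant, `m ≤ K(z, ·)` for all `z` (`m` finite, `m(Ω) ≠ 0`); `σ²_w > 0`; windows `W_n → ∞`,
`W_n³/n → 0`; `z > 0`; `R = card ι` independent streams from ANY record laws `μ r`.  With
`Ȳ_{R,n} = (Σ_r Σ_{i<n} e^{−W(ω^r_i)})/(R n)` and `V̂_{R,n} = (Σ_r Γ̂^r_n(0) · 2 τ̂^r_{n,W_n})/R`: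
`P{ |√(R n) (−log Ȳ_{R,n} − ΔF) · Ȳ_{R,n} · (√V̂_{R,n})⁻¹| ≤ z } → gaussianReal 0 1 (Icc (−z) z)`. -/
theorem tendsto_measure_studentized_pooledJarzynski_le_restartChains (K : Kernel Ω Ω)
    [IsMarkovKernel K] (h0 : ν₀ univ ≠ 0) (hK : Kernel.Invariant K ν₀)
    (h : CrooksPair ν₀ ν₁ κF κR s e W) {ΔF : ℝ}
    (hΔF : Real.exp (-ΔF) = ((ν₀ univ)⁻¹ * ν₁ univ).toReal) {m : Measure Ω} [IsFiniteMeasure m]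
    (hm0 : m univ ≠ 0) (hmin : ∀ z, m ≤ K z) {B : ℝ} (hB : ∀ ω, -B ≤ W ω)
    (hσ : 0 < Scoring.autocov ((κF ∘ₖ K).comap s h.measurable_s) (fwdPathLaw ν₀ κF)
          (fun ω => Real.exp (-W ω) - ((ν₀ univ)⁻¹ * ν₁ univ).toReal) 0
        + 2 * ∑' t, Scoring.autocov ((κF ∘ₖ K).comap s h.measurable_s) (fwdPathLaw ν₀ κF)
          (fun ω => Real.exp (-W ω) - ((ν₀ univ)⁻¹ * ν₁ univ).toReal) (t + 1))
    {Wn : ℕ → ℕ} (hW : Tendsto Wn atTop atTop)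
    (hW3 : Tendsto (fun n => (Wn n : ℝ) ^ 3 / n) atTop (𝓝 0)) {z : ℝ} (hz : 0 < z)
    (μ : ι → Measure E) [∀ r, IsProbabilityMeasure (μ r)]
    [∀ r, IsProbabilityMeasure (Kernel.trajMeasure (X := fun _ : ℕ => E) (μ r)
        (fun n : ℕ => ((κF ∘ₖ K).comap s h.measurable_s).comap
          (fun hh : (j : ↥(Finset.Iic n)) → E => hh ⟨n, Finset.mem_Iic.2 le_rfl⟩)
          (measurable_pi_apply _)))] :
    Tendsto (fun n : ℕ => (Measure.pi fun r => Kernel.trajMeasure (X := fun _ : ℕ => E) (μ r)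
        (fun n : ℕ => ((κF ∘ₖ K).comap s h.measurable_s).comap
          (fun hh : (j : ↥(Finset.Iic n)) → E => hh ⟨n, Finset.mem_Iic.2 le_rfl⟩)
          (measurable_pi_apply _)))
        {ω : ι → ℕ → E | |Real.sqrt ((Fintype.card ι : ℝ) * n)
            * (-Real.log ((∑ r, ∑ i ∈ range n, Real.exp (-W (ω r i))) / ((Fintype.card ι : ℝ) * n))
              - ΔF)
            * ((∑ r, ∑ i ∈ range n, Real.exp (-W (ω r i))) / ((Fintype.card ι : ℝ) * n))
            * (Real.sqrt ((∑ r, Scoring.gammaHat (fun i => Real.exp (-W (ω r i))) n 0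
              * (2 * Scoring.tauIntWindow
                (Scoring.rhoHat (fun i => Real.exp (-W (ω r i))) n) (Wn n))) / Fintype.card ι))⁻¹|
          ≤ z})
      atTop (𝓝 (gaussianReal 0 1 (Icc (-z) z))) := by
  haveI := isProbabilityMeasure_fwdPathLaw ν₀ h0 κF
  haveI := isProbabilityMeasure_normalised_bind_kernel κF hm0
  set θ : ℝ := ((ν₀ univ)⁻¹ * ν₁ univ).toReal with hθdef
  have hθ : 0 < θ := by rw [← hΔF]; exact Real.exp_pos _
  have hθi : ∫ z, Real.exp (-W z) ∂(fwdPathLaw ν₀ κF) = θ := h.integral_exp_neg_work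
  have hwm : Measurable fun ε => Real.exp (-W ε) := Real.measurable_exp.comp h.measurable_W.neg
  have hC : ∀ ω, |Real.exp (-W ω)| ≤ Real.exp B := fun ω => by
    rw [abs_of_pos (Real.exp_pos _)]
    exact Real.exp_le_exp.2 (by linarith [hB ω])
  -- the studentized pooled CLT of the weights along the restart chain (GEN-23, `m = 1`)
  have hσ' : 0 < Scoring.autocov ((κF ∘ₖ K).comap s h.measurable_s) (fwdPathLaw ν₀ κF)
          (fun ω => Real.exp (-W ω) - ∫ z, Real.exp (-W z) ∂(fwdPathLaw ν₀ κF)) 0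
        + 2 * ∑' t, Scoring.autocov ((κF ∘ₖ K).comap s h.measurable_s) (fwdPathLaw ν₀ κF)
          (fun ω => Real.exp (-W ω) - ∫ z, Real.exp (-W z) ∂(fwdPathLaw ν₀ κF)) (t + 1) := by
    rw [hθi]; exact hσ
  have hU := tendstoInDistribution_studentized_pooledSum_of_nHit (h.invariant_restartKernel K hK) hm0
    (restartKernel_nHit_one_minorised K h hm0 hmin) Nat.one_pos hwm hC hσ' hW hW3 μ
  rw [hθi] at hU
  have hae := h.tendsto_pooledMeanWeight_ae_restartChains K h0 hK hm0 hmin μ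
  -- name the replica law and the pooled mean weight (`set` acts definitionally on `hU` / `hae`)
  set P := Measure.pi fun r => Kernel.trajMeasure (X := fun _ : ℕ => E) (μ r)
    (fun n : ℕ => ((κF ∘ₖ K).comap s h.measurable_s).comap
      (fun hh : (j : ↥(Finset.Iic n)) → E => hh ⟨n, Finset.mem_Iic.2 le_rfl⟩)
      (measurable_pi_apply _)) with hP
  set Ybar : ℕ → (ι → ℕ → E) → ℝ := fun n ω =>
    (∑ r, ∑ i ∈ range n, Real.exp (-W (ω r i))) / ((Fintype.card ι : ℝ) * n) with hYbar
  have hYm : ∀ n, Measurable (Ybar n) := fun n =>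
    (Finset.measurable_sum _ fun r _ => Finset.measurable_sum _ fun i _ =>
      hwm.comp ((measurable_pi_apply i).comp (measurable_pi_apply r))).div_const _
  -- the slope factor `−Ȳ · dslope log θ Ȳ → −1` almost surely, hence in probability
  have hBm : ∀ n, Measurable fun ω : ι → ℕ → E =>
      -(Ybar n ω * dslope Real.log θ (Ybar n ω)) :=
    fun n => ((hYm n).mul ((measurable_dslope_log θ).comp (hYm n))).neg
  have hBconv : TendstoInMeasure P (fun n (ω : ι → ℕ → E) =>
      -(Ybar n ω * dslope Real.log θ (Ybar n ω))) atTop (fun _ => -1) := by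
    refine tendstoInMeasure_of_tendsto_ae (fun n => (hBm n).aestronglyMeasurable) ?_
    filter_upwards [hae] with ω hω
    have hcont : ContinuousAt (dslope Real.log θ) θ :=
      continuousAt_dslope_same.2 (Real.differentiableAt_log hθ.ne')
    have hval : dslope Real.log θ θ = θ⁻¹ := by rw [dslope_same, Real.deriv_log]
    have hd : Tendsto (fun n : ℕ => dslope Real.log θ (Ybar n ω)) atTop (𝓝 θ⁻¹) := by
      rw [← hval]; exact hcont.tendsto.comp hω
    have h1 : (-1 : ℝ) = -(θ * θ⁻¹) := by rw [mul_inv_cancel₀ hθ.ne']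
    rw [h1]
    exact (hω.mul hd).neg
  have key := tendsto_measure_abs_mul_le_of_clt_of_tendstoInMeasure hBm HasLaw.id hU hBconv hz
  have hone : NNReal.mk ((-1 : ℝ) ^ 2) (sq_nonneg _) * (1 : NNReal) = 1 := by
    apply NNReal.eq; simp
  rw [hone] at key
  -- the two events coincide surely
  have hΔF' : ΔF = -Real.log θ := by rw [← hΔF, Real.log_exp, neg_neg]
  refine key.congr fun n => ?_
  congr 1
  ext ω
  simp only [Set.mem_setOf_eq]
  have hds := sub_smul_dslope Real.log θ (Ybar n ω)
  rw [smul_eq_mul] at hds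
  have hsm : (Real.sqrt ((Fintype.card ι : ℝ) * n))⁻¹
        * ∑ r, ∑ i ∈ range n, (Real.exp (-W (ω r i)) - θ)
      = Real.sqrt ((Fintype.card ι : ℝ) * n) * (Ybar n ω - θ) :=
    invSqrt_mul_sum_sub_eq_sqrt_mul (fun r i => Real.exp (-W (ω r i))) θ n
  rw [show (∑ r, ∑ i ∈ range n, Real.exp (-W (ω r i))) / ((Fintype.card ι : ℝ) * n) = Ybar n ω
      from rfl, hsm, hΔF']
  have hid : Real.sqrt ((Fintype.card ι : ℝ) * n) * (-Real.log (Ybar n ω) - -Real.log θ) * Ybar n ω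
        * (Real.sqrt ((∑ r, Scoring.gammaHat (fun i => Real.exp (-W (ω r i))) n 0
          * (2 * Scoring.tauIntWindow (Scoring.rhoHat (fun i => Real.exp (-W (ω r i))) n) (Wn n)))
            / Fintype.card ι))⁻¹
      = Real.sqrt ((Fintype.card ι : ℝ) * n) * (Ybar n ω - θ)
        * (Real.sqrt ((∑ r, Scoring.gammaHat (fun i => Real.exp (-W (ω r i))) n 0
          * (2 * Scoring.tauIntWindow (Scoring.rhoHat (fun i => Real.exp (-W (ω r i))) n) (Wn n)))
            / Fintype.card ι))⁻¹
        * -(Ybar n ω * dslope Real.log θ (Ybar n ω)) := by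
    linear_combination (Real.sqrt ((Fintype.card ι : ℝ) * n) * Ybar n ω
      * (Real.sqrt ((∑ r, Scoring.gammaHat (fun i => Real.exp (-W (ω r i))) n 0
          * (2 * Scoring.tauIntWindow (Scoring.rhoHat (fun i => Real.exp (-W (ω r i))) n) (Wn n)))
            / Fintype.card ι))⁻¹) * hds
  rw [hid]

/-- **THE PRINTED POOLED INTERVAL OF THE JARZYNSKI LANE CONTAINS `ΔF` WITH ASYMPTOTICALLY NOMINAL
PROBABILITY, EVERY FAMILY OF INITIAL RECORD LAWS.**  Under the hypotheses of
`tendsto_measure_studentized_pooledJarzynski_le_restartChains`: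
`P{ |ΔF̂_{R,n} − ΔF| ≤ z √(V̂_{R,n}/(R n)) / Ȳ_{R,n} } → gaussianReal 0 1 (Icc (−z) z)`. -/
theorem tendsto_measure_pooledJarzynski_mem_gammaInterval_restartChains (K : Kernel Ω Ω)
    [IsMarkovKernel K] (h0 : ν₀ univ ≠ 0) (hK : Kernel.Invariant K ν₀)
    (h : CrooksPair ν₀ ν₁ κF κR s e W) {ΔF : ℝ}
    (hΔF : Real.exp (-ΔF) = ((ν₀ univ)⁻¹ * ν₁ univ).toReal) {m : Measure Ω} [IsFiniteMeasure m]
    (hm0 : m univ ≠ 0) (hmin : ∀ z, m ≤ K z) {B : ℝ} (hB : ∀ ω, -B ≤ W ω)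
    (hσ : 0 < Scoring.autocov ((κF ∘ₖ K).comap s h.measurable_s) (fwdPathLaw ν₀ κF)
          (fun ω => Real.exp (-W ω) - ((ν₀ univ)⁻¹ * ν₁ univ).toReal) 0
        + 2 * ∑' t, Scoring.autocov ((κF ∘ₖ K).comap s h.measurable_s) (fwdPathLaw ν₀ κF)
          (fun ω => Real.exp (-W ω) - ((ν₀ univ)⁻¹ * ν₁ univ).toReal) (t + 1))
    {Wn : ℕ → ℕ} (hW : Tendsto Wn atTop atTop)
    (hW3 : Tendsto (fun n => (Wn n : ℝ) ^ 3 / n) atTop (𝓝 0)) {z : ℝ} (hz : 0 < z)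
    (μ : ι → Measure E) [∀ r, IsProbabilityMeasure (μ r)]
    [∀ r, IsProbabilityMeasure (Kernel.trajMeasure (X := fun _ : ℕ => E) (μ r)
        (fun n : ℕ => ((κF ∘ₖ K).comap s h.measurable_s).comap
          (fun hh : (j : ↥(Finset.Iic n)) → E => hh ⟨n, Finset.mem_Iic.2 le_rfl⟩)
          (measurable_pi_apply _)))] :
    Tendsto (fun n : ℕ => (Measure.pi fun r => Kernel.trajMeasure (X := fun _ : ℕ => E) (μ r)
        (fun n : ℕ => ((κF ∘ₖ K).comap s h.measurable_s).comap
          (fun hh : (j : ↥(Finset.Iic n)) → E => hh ⟨n, Finset.mem_Iic.2 le_rfl⟩)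
          (measurable_pi_apply _)))
        {ω : ι → ℕ → E |
          |-Real.log ((∑ r, ∑ i ∈ range n, Real.exp (-W (ω r i))) / ((Fintype.card ι : ℝ) * n)) - ΔF|
          ≤ z * Real.sqrt (((∑ r, Scoring.gammaHat (fun i => Real.exp (-W (ω r i))) n 0
              * (2 * Scoring.tauIntWindow
                (Scoring.rhoHat (fun i => Real.exp (-W (ω r i))) n) (Wn n))) / Fintype.card ι)
                / ((Fintype.card ι : ℝ) * n))
            / ((∑ r, ∑ i ∈ range n, Real.exp (-W (ω r i))) / ((Fintype.card ι : ℝ) * n))})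
      atTop (𝓝 (gaussianReal 0 1 (Icc (-z) z))) := by
  haveI := isProbabilityMeasure_fwdPathLaw ν₀ h0 κF
  haveI := isProbabilityMeasure_normalised_bind_kernel κF hm0
  set θ : ℝ := ((ν₀ univ)⁻¹ * ν₁ univ).toReal with hθdef
  have hθi : ∫ z, Real.exp (-W z) ∂(fwdPathLaw ν₀ κF) = θ := h.integral_exp_neg_work
  have hwm : Measurable fun ε => Real.exp (-W ε) := Real.measurable_exp.comp h.measurable_W.neg
  have hC : ∀ ω, |Real.exp (-W ω)| ≤ Real.exp B := fun ω => by
    rw [abs_of_pos (Real.exp_pos _)]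
    exact Real.exp_le_exp.2 (by linarith [hB ω])
  have hR : 0 < (Fintype.card ι : ℝ) := by exact_mod_cast Fintype.card_pos
  set σ2 := Scoring.autocov ((κF ∘ₖ K).comap s h.measurable_s) (fwdPathLaw ν₀ κF)
      (fun ω => Real.exp (-W ω) - θ) 0
    + 2 * ∑' t, Scoring.autocov ((κF ∘ₖ K).comap s h.measurable_s) (fwdPathLaw ν₀ κF)
      (fun ω => Real.exp (-W ω) - θ) (t + 1) with hσ2
  -- the studentized coverage
  have hE := h.tendsto_measure_studentized_pooledJarzynski_le_restartChains K h0 hK hΔF hm0 hmin hB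
    hσ hW hW3 hz μ
  -- the pooled variance statistic converges in probability to `σ²_w > 0`
  have hcons := pooledGammaWindow_tendstoInMeasure_of_nHit (h.invariant_restartKernel K hK) hm0
    (restartKernel_nHit_one_minorised K h hm0 hmin) Nat.one_pos hwm hC hW hW3 μ
  rw [hθi] at hcons
  set P := Measure.pi fun r => Kernel.trajMeasure (X := fun _ : ℕ => E) (μ r)
    (fun n : ℕ => ((κF ∘ₖ K).comap s h.measurable_s).comap
      (fun hh : (j : ↥(Finset.Iic n)) → E => hh ⟨n, Finset.mem_Iic.2 le_rfl⟩)
      (measurable_pi_apply _)) with hP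
  set V : ℕ → (ι → ℕ → E) → ℝ := fun n ω => (∑ r, Scoring.gammaHat (fun i => Real.exp (-W (ω r i))) n 0
    * (2 * Scoring.tauIntWindow (Scoring.rhoHat (fun i => Real.exp (-W (ω r i))) n) (Wn n)))
      / Fintype.card ι with hV
  set Bn : ℕ → Set (ι → ℕ → E) := fun n => {ω | V n ω ≤ 0} ∪ {ω | n = 0} with hBdef
  have hBt : Tendsto (fun n => P (Bn n)) atTop (𝓝 0) := by
    have h1 : Tendsto (fun n => P {ω | V n ω ≤ 0}) atTop (𝓝 0) := by
      have hc := hcons (ENNReal.ofReal σ2) (by simpa using hσ)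
      refine tendsto_of_tendsto_of_tendsto_of_le_of_le tendsto_const_nhds hc (fun n => bot_le)
        fun n => measure_mono fun ω hω => ?_
      simp only [Set.mem_setOf_eq] at hω ⊢
      rw [edist_dist, Real.dist_eq]
      refine ENNReal.ofReal_le_ofReal ?_
      rw [show V n ω = (∑ r, Scoring.gammaHat (fun i => Real.exp (-W (ω r i))) n 0
          * (2 * Scoring.tauIntWindow (Scoring.rhoHat (fun i => Real.exp (-W (ω r i))) n) (Wn n)))
          / Fintype.card ι from rfl] at hω
      rw [abs_sub_comm]
      linarith [le_abs_self (σ2 - (∑ r, Scoring.gammaHat (fun i => Real.exp (-W (ω r i))) n 0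
        * (2 * Scoring.tauIntWindow (Scoring.rhoHat (fun i => Real.exp (-W (ω r i))) n) (Wn n)))
        / Fintype.card ι)]
    have h2 : Tendsto (fun n : ℕ => P {ω : ι → ℕ → E | n = 0}) atTop (𝓝 0) := by
      refine tendsto_const_nhds.congr' ?_
      filter_upwards [Filter.eventually_gt_atTop 0] with n hn
      rw [show {ω : ι → ℕ → E | n = 0} = ∅ from Set.eq_empty_of_forall_notMem fun ω hω => hn.ne' hω,
        measure_empty]
    have h12 := h1.add h2
    rw [add_zero] at h12
    exact tendsto_of_tendsto_of_tendsto_of_le_of_le tendsto_const_nhds h12 (fun n => bot_le)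
      fun n => measure_union_le _ _
  -- positivity of the pooled mean weight for `n ≥ 1`
  have hYpos : ∀ {n : ℕ}, 0 < n → ∀ ω : ι → ℕ → E,
      0 < (∑ r, ∑ i ∈ range n, Real.exp (-W (ω r i))) / ((Fintype.card ι : ℝ) * n) := by
    intro n hn ω
    have hn' : (0 : ℝ) < n := by exact_mod_cast hn
    refine div_pos (Finset.sum_pos (fun r _ => Finset.sum_pos (fun i _ => Real.exp_pos _)
      (Finset.nonempty_range_iff.2 hn.ne')) Finset.univ_nonempty) (by positivity)
  refine tendsto_measure_of_eq_off_vanishing hBt (fun n => ?_) hE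
  ext ω
  simp only [hBdef, hV, Set.mem_inter_iff, Set.mem_compl_iff, Set.mem_union, Set.mem_setOf_eq, not_or,
    not_le]
  constructor
  · rintro ⟨hle, hVpos, hn⟩
    refine ⟨?_, hVpos, hn⟩
    have hN : 0 < (Fintype.card ι : ℝ) * n := by
      have hn' : (0 : ℝ) < n := by exact_mod_cast Nat.pos_of_ne_zero hn
      positivity
    exact (abs_studentizedLog_le_iff_real hN (z := z)
      (D := -Real.log ((∑ r, ∑ i ∈ range n, Real.exp (-W (ω r i))) / ((Fintype.card ι : ℝ) * n))
        - ΔF) hVpos (hYpos (Nat.pos_of_ne_zero hn) ω)).1 hle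
  · rintro ⟨hle, hVpos, hn⟩
    refine ⟨?_, hVpos, hn⟩
    have hN : 0 < (Fintype.card ι : ℝ) * n := by
      have hn' : (0 : ℝ) < n := by exact_mod_cast Nat.pos_of_ne_zero hn
      positivity
    exact (abs_studentizedLog_le_iff_real hN (z := z)
      (D := -Real.log ((∑ r, ∑ i ∈ range n, Real.exp (-W (ω r i))) / ((Fintype.card ι : ℝ) * n))
        - ΔF) hVpos (hYpos (Nat.pos_of_ne_zero hn) ω)).2 hle

/-- **THE PRINTED POOLED INTERVAL FROM EVERY FAMILY OF LAUNCH CONFIGURATIONS** (the engine's form: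
replica `r` first launched from ANY configuration `x r`, then `K` between launches, streams
independent): `P{ |ΔF̂_{R,n} − ΔF| ≤ z √(V̂_{R,n}/(R n)) / Ȳ_{R,n} } → gaussianReal 0 1 (Icc (−z) z)`. -/
theorem tendsto_measure_pooledJarzynski_mem_gammaInterval_restartChains_everyStart (K : Kernel Ω Ω)
    [IsMarkovKernel K] (h0 : ν₀ univ ≠ 0) (hK : Kernel.Invariant K ν₀)
    (h : CrooksPair ν₀ ν₁ κF κR s e W) {ΔF : ℝ}
    (hΔF : Real.exp (-ΔF) = ((ν₀ univ)⁻¹ * ν₁ univ).toReal) {m : Measure Ω} [IsFiniteMeasure m]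
    (hm0 : m univ ≠ 0) (hmin : ∀ z, m ≤ K z) {B : ℝ} (hB : ∀ ω, -B ≤ W ω)
    (hσ : 0 < Scoring.autocov ((κF ∘ₖ K).comap s h.measurable_s) (fwdPathLaw ν₀ κF)
          (fun ω => Real.exp (-W ω) - ((ν₀ univ)⁻¹ * ν₁ univ).toReal) 0
        + 2 * ∑' t, Scoring.autocov ((κF ∘ₖ K).comap s h.measurable_s) (fwdPathLaw ν₀ κF)
          (fun ω => Real.exp (-W ω) - ((ν₀ univ)⁻¹ * ν₁ univ).toReal) (t + 1))
    {Wn : ℕ → ℕ} (hW : Tendsto Wn atTop atTop)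
    (hW3 : Tendsto (fun n => (Wn n : ℝ) ^ 3 / n) atTop (𝓝 0)) {z : ℝ} (hz : 0 < z) (x : ι → Ω)
    [∀ r, IsProbabilityMeasure (Kernel.trajMeasure (X := fun _ : ℕ => E) (κF (x r))
        (fun n : ℕ => ((κF ∘ₖ K).comap s h.measurable_s).comap
          (fun hh : (j : ↥(Finset.Iic n)) → E => hh ⟨n, Finset.mem_Iic.2 le_rfl⟩)
          (measurable_pi_apply _)))] :
    Tendsto (fun n : ℕ => (Measure.pi fun r => Kernel.trajMeasure (X := fun _ : ℕ => E) (κF (x r))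
        (fun n : ℕ => ((κF ∘ₖ K).comap s h.measurable_s).comap
          (fun hh : (j : ↥(Finset.Iic n)) → E => hh ⟨n, Finset.mem_Iic.2 le_rfl⟩)
          (measurable_pi_apply _)))
        {ω : ι → ℕ → E |
          |-Real.log ((∑ r, ∑ i ∈ range n, Real.exp (-W (ω r i))) / ((Fintype.card ι : ℝ) * n)) - ΔF|
          ≤ z * Real.sqrt (((∑ r, Scoring.gammaHat (fun i => Real.exp (-W (ω r i))) n 0
              * (2 * Scoring.tauIntWindow
                (Scoring.rhoHat (fun i => Real.exp (-W (ω r i))) n) (Wn n))) / Fintype.card ι)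
                / ((Fintype.card ι : ℝ) * n))
            / ((∑ r, ∑ i ∈ range n, Real.exp (-W (ω r i))) / ((Fintype.card ι : ℝ) * n))})
      atTop (𝓝 (gaussianReal 0 1 (Icc (-z) z))) :=
  h.tendsto_measure_pooledJarzynski_mem_gammaInterval_restartChains K h0 hK hΔF hm0 hmin hB hσ hW
    hW3 hz (fun r => κF (x r))

end CrooksPair

end Summit.Ventures.LatticeQCDFlow.Exactness.GeneralNCMC
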